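import Literature.MathematicalPhysics.QuantumFieldTheory.Balaban1983to89.B6Cover236MultiLevelTorusReachBigL0
import Literature.MathematicalPhysics.QuantumFieldTheory.Balaban1983to89.B6Partition118KLevelTorusCentralL0
import HarnessLib
import Literature.MathematicalPhysics.QuantumFieldTheory.Balaban1983to89.B6Cover236MultiLevelBlocksL0
import Literature.MathematicalPhysics.QuantumFieldTheory.Balaban1983to89.B6Geom246MultiLevelBoxL0
import Literature.MathematicalPhysics.QuantumFieldTheory.Balaban1983to89.B6Geom246MultiLevelTorusL0
import Literature.MathematicalPhysics.QuantumFieldTheory.Balaban1983to89.B6MultiLevelBoxOperatorL0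
import Literature.MathematicalPhysics.QuantumFieldTheory.Balaban1983to89.B6MultiLevelTorusOperatorL0
import Literature.MathematicalPhysics.QuantumFieldTheory.Balaban1983to89.B6Partition118KLevelFineLipL0
import Literature.MathematicalPhysics.QuantumFieldTheory.Balaban1983to89.B6Partition118KLevelTorusChartL0
import Literature.MathematicalPhysics.QuantumFieldTheory.Balaban1983to89.B6TorusDepthDistanceL0

/-!
# `Balaban1983to89.B6Line3GapV1L0` — LEVEL-0 TWIN (programme G-F3′-L0, director-ym LINE №27 / UV3-NODE §24.5; plan `lit-balaban-r03/G-F3L0-PLAN.md`) of `B6Line3GapV1`: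
the same declarations, SAME NAMES AND STATEMENTS, for nested families WITH print's region `Λ₀ = T ∖ Ω₁` ADMITTED (structures
`B6MultiLevelBoxOperatorL0.Domains` / `B6MultiLevelTorusOperatorL0.TDomains`: levels `0, …, k`, the level-`0` block a single site, `Q′₀ = id`,
finite weight `a₀` — print p.225 (2.14) «Σ_{j=0}^k … (Q′₀λ)(x) = λ(x), x ∈ Λ₀», p.229 «taking a sequence (2.1) … smallest possible domains B^j(Λ_j),
and considering the operator Δ_a defined by (2.19), (2.20) for this sequence»).  Every `D`-free object is the lineage's, consumed BY NAME; no existing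
module is touched; no fact is minted.  Unit `lit-balaban-r03` (B6 fold owner, r03 gen 36); referee ref-4.  THE TWIN'S DOCUMENTATION FOLLOWS
VERBATIM (its «levels 1 … k» / «Ω₁ = X» sentences describe the twin; here `j` runs from `0` and `Ω₁` may be a proper subset).

# `Balaban1983to89.B6Line3GapV1` — T. Bałaban, *Propagators and renormalization transformations for lattice gauge theories. II*,
# Commun. Math. Phys. **96** (1984) 223–250 [Balaban1984PropagatorsII], (2.46) p. 231 with (2.2) p. 224 and p. 238–239: THE GAP, IN THE MULTISCALE
# DISTANCE (2.46) ON THE TORUS, BETWEEN THE CUT-OFF CUBE `□̃` AND THE BLOCKS FAR FROM THE CENTRE OF `□` — the depth `M₀ ≥ M_h/(4L)` of the line-3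
# cut-offs below the zone of the domain change

statement-level skeleton of published theorems with citation tags; proofs where landed; nothing here is a claim about the Yang–Mills mass gap

PDF held: `paper:balaban1984-cmp96-propagators-rt-ii` (journal page = PDF page + 222): p. 231 [PDF 9] ((2.45)–(2.46) the distance `d(y, y′)`), p. 224
[PDF 2] ((2.2) the `RM` separation of the levels), p. 238 [PDF 16] (*"gives a factor O(M⁻¹)"*, `□ ⊂ □̃ ⊂ □̃² ⊂ □̃³`), p. 247 [PDF 25] ((2.134):
*"ζ_□(y) − 1 = 0 for d(y, y′) ≦ M"*).

CITATION HEADER (lean-in-tree rule) — WHAT IS REPRODUCED.  Phase-2 file of the `lit-balaban` typed skeleton (HOME `run/shared/lean/pub/lit-balaban/`),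
unit `lit-balaban-r03` (B6 fold owner; r03 gen 22, literature-prover-lit-balaban-r03-g22-0), referee ref-4.  SKELETON rows **B6.Eq2.45** (the distance
(2.46)) × **B6.Prop2.6** × B6.Eq2.92 (cells; decls of record untouched).  Input of B6-CLOSURE §5 item 16 (the depth `M₀` of the hypotheses `hζdeep`/`hhdeep`
of p22's `…B6Line3WindowV1.line3_window`).  IMPORTS BY NAME, restating nothing: `…B6Cover236MultiLevelBlocks` (p21: `cubes`, `ctr`, `side`, `far_exit`,
`dist_cen_le_of_adj`), `…B6Cover236MultiLevelTorusReachBig` (p21: `window_big`), `…B6Partition118KLevelFineLip` (p38: `Qbig`), `…B6Partition118KLevelTorusCentral`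
(p38: `Dch`, `cc`, `ctr_cc_bounds`, `side_cc`), `…B6TorusDepthDistance` (p38: `BlkDeep`, `distT_trichotomy`).

## WHAT THIS FILE CERTIFIES (kernel-checked, 0 sorry, standard axioms; THEOREMS ONLY — no `def`, no new named fact)

* `walk_disp_or_exit_lev` — p21's walk induction with the level of the end block recorded: a chain of admissible bonds from a block of level `≤ m`
  either stays at levels `≤ m` (and then displaces the centre by `≤ |Γ|·L^m`) or reaches a site of level `≥ m + 1` within `|Γ|·L^m`.
* `gap_box_far` — **THE GAP IN THE BOX**: a block `y` of `□̃` (centre within `7S/4` of the centre of `□`) and a block `y′` containing a site `x′`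
  with `|x′_μ − ctr_μ| ≥ 2S − 1` for some `μ` are at least `M_h/8` admissible bonds apart (`M_h ≥ 16`, `R ≥ 3L`): the shortest chain either covers the
  sup-gap `3S/16 − 1` at `≤ L^{j+1} = S/M_h` per bond, or exits to `B^{j+2}` which (2.2) puts `> (RL − 9/4)S` away.
* `blkDeep_of_mem_Qbig` — the blocks of `□̃` of the central cube of a chart are `⌊S/2⌋`-deep (and of level `≤ j + 1`).
* `distT_far` — **THE GAP ON THE TORUS**: the same pair is at least `M_h/(4L)` apart in the torus distance (2.46) (p38's trichotomy: the torus geodesic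
  is a box geodesic, or is long at the scale of `y`, or climbs two levels).
* `abs_sub_ctr_le_of_mem_Qbig` — the sites of a block of `□̃` are within `7S/4 + S/16` (each coordinate) of the centre.

## HONEST SCOPE / DIVERGENCES

(1) Print's *"ζ_□(y) − 1 = 0 for d(y, y′) ≦ M"* (p. 247) is the qualitative content; the constants `M_h/8`, `M_h/(4L)`, the threshold `M_h ≥ 16` and
the radius `2S − 1` are ours (bookkeeping for the quarter-point window of ROUTE V, `L ≥ 5`).  (2) Distance (2.46) in p21's reading R2 (touching
blocks; G-B6-22).  (3) Integer torus, lattice units; NOT summit progress.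
-/

open scoped BigOperators

namespace Literature.MathematicalPhysics.QuantumFieldTheory.Balaban1983to89.B6Line3GapV1L0

open Finset
open B4ContourShift (supNorm)
open B4Reflection242 (boxDom mem_boxDom blk)
open B6MultiLevelBoxOperator (N0 bigSide bigSide_eq one_le_bigSide)
open B6MultiLevelBoxOperatorL0 (Domains)
open B6MultiLevelTorusOperatorL0 (TDomains)
open B6Geom246MultiLevelBox (toR supNorm_eq_dist)
open B6Geom246MultiLevelBoxL0 (bset blkOf cen bond dist_toR_cen_le lev_eq_of_blkOf_eq bond_adj dist_cen_le_of_adj connected coord_bounds)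
open B6Geom246MultiLevelTorusL0 (bondT distT_le_dist_box)
open B6Cover236MultiLevelBlocksL0 (cubes side side_eq side_pos ctr far_exit)
open B6Cover236MultiLevelTorusReachBigL0 (window_big)
open B6Partition118KLevelFineLipL0 (Qbig mem_Qbig)
open B6Eq238MultiLevelTorus (svec)
open B6Partition118KLevelTorusCentral (one_le_of_four_le)
open B6Partition118KLevelTorusCentralL0 (Dch cc side_cc ctr_cc_bounds)
open B6Partition118KLevelTorusChartL0 (side_le_bigSide_k)
open B6TorusDepthDistance (SiteDeep)
open B6TorusDepthDistanceL0 (BlkDeep distT_trichotomy)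

noncomputable section

variable {d : ℕ} {ℓ Mh k R : ℕ} {P : Fin (d + 1) → ℕ}

/-! ## §1  The walk induction with the level of the end block -/

/-- powers of `L` are monotone (real form). [cite: Balaban1984PropagatorsII, (2.1) p.224, bookkeeping] -/
private theorem powL_mono {a b : ℕ} (h : a ≤ b) : (((ℓ + 1) ^ a : ℕ) : ℝ) ≤ (((ℓ + 1) ^ b : ℕ) : ℝ) := by
  exact_mod_cast Nat.pow_le_pow_right (by omega) h

/-- **THE WALK INDUCTION OF (2.2) ⇒ (2.57), WITH THE END LEVEL**: a chain of admissible bonds from a block `a` of level `≤ m` EITHER stays at levels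
`≤ m` up to its end `b` (so `j(b) ≤ m`) and displaces the centre by `≤ |Γ|·L^m`, OR reaches a SITE of level `≥ m + 1` within `|Γ|·L^m` of the centre of
`a` (p21's `walk_disp_or_exit`, end level recorded). [cite: Balaban1984PropagatorsII, (2.2) p.224, (2.46) p.231, (2.57) p.233] -/
theorem walk_disp_or_exit_lev {D : B6MultiLevelBoxOperatorL0.Domains d ℓ Mh k P R} {m : ℕ} :
    ∀ {a b : ↥(bset D)} (p : (bond D).Walk a b), a.1.1 ≤ m →
      (b.1.1 ≤ m ∧ dist (cen D a) (cen D b) ≤ (p.length : ℝ) * (((ℓ + 1) ^ m : ℕ) : ℝ)) ∨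
      ∃ t : ↥(boxDom (N0 ℓ Mh k P)), m + 1 ≤ D.lev t.1 ∧
        dist (cen D a) (toR t.1) ≤ (p.length : ℝ) * (((ℓ + 1) ^ m : ℕ) : ℝ) := by
  intro a b p
  induction p with
  | nil => intro ha; left; exact ⟨ha, by rw [SimpleGraph.Walk.length_nil, dist_self]; simp⟩
  | @cons a c b h p ih =>
    intro ha
    have hLm : (1 : ℝ) ≤ (((ℓ + 1) ^ m : ℕ) : ℝ) := by exact_mod_cast Nat.one_le_pow _ _ (by omega)
    have hlen : (((SimpleGraph.Walk.cons h p).length : ℕ) : ℝ) = (p.length : ℝ) + 1 := by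
      rw [SimpleGraph.Walk.length_cons]; push_cast; ring
    have hpl : (0 : ℝ) ≤ (p.length : ℝ) := by positivity
    by_cases hc : m < c.1.1
    · -- the first bond already exits
      right
      obtain ⟨-, x₁, x₂, hx₁, hx₂, hd⟩ := bond_adj.1 h
      refine ⟨x₂, by rw [lev_eq_of_blkOf_eq D hx₂]; omega, ?_⟩
      rw [supNorm_eq_dist] at hd
      have h1 := dist_toR_cen_le D hx₁
      rw [dist_comm] at h1
      have ha1 := powL_mono (ℓ := ℓ) ha
      calc dist (cen D a) (toR x₂.1) ≤ dist (cen D a) (toR x₁.1) + dist (toR x₁.1) (toR x₂.1) := dist_triangle _ _ _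
        _ ≤ ((((ℓ + 1) ^ a.1.1 : ℕ) : ℝ) - 1) / 2 + 1 := by linarith
        _ ≤ (((ℓ + 1) ^ m : ℕ) : ℝ) := by linarith
        _ ≤ (((SimpleGraph.Walk.cons h p).length : ℕ) : ℝ) * (((ℓ + 1) ^ m : ℕ) : ℝ) := by rw [hlen]; nlinarith
    · push Not at hc
      have hab : dist (cen D a) (cen D c) ≤ (((ℓ + 1) ^ m : ℕ) : ℝ) := (dist_cen_le_of_adj h).trans (powL_mono (max_le ha hc))
      rcases ih hc with ⟨hb, hdisp⟩ | ⟨t, ht, hdist⟩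
      · left
        refine ⟨hb, ?_⟩
        calc dist (cen D a) (cen D b) ≤ dist (cen D a) (cen D c) + dist (cen D c) (cen D b) := dist_triangle _ _ _
          _ ≤ (((ℓ + 1) ^ m : ℕ) : ℝ) + (p.length : ℝ) * (((ℓ + 1) ^ m : ℕ) : ℝ) := add_le_add hab hdisp
          _ = (((SimpleGraph.Walk.cons h p).length : ℕ) : ℝ) * (((ℓ + 1) ^ m : ℕ) : ℝ) := by rw [hlen]; ring
      · right
        refine ⟨t, ht, ?_⟩
        calc dist (cen D a) (toR t.1) ≤ dist (cen D a) (cen D c) + dist (cen D c) (toR t.1) := dist_triangle _ _ _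
          _ ≤ (((ℓ + 1) ^ m : ℕ) : ℝ) + (p.length : ℝ) * (((ℓ + 1) ^ m : ℕ) : ℝ) := add_le_add hab hdist
          _ = (((SimpleGraph.Walk.cons h p).length : ℕ) : ℝ) * (((ℓ + 1) ^ m : ℕ) : ℝ) := by rw [hlen]; ring

/-! ## §2  The gap in the box between `□̃` and the far blocks -/

/-- a block met near a level-`j` cube (level `≤ j + 1`) has side `≤ S/M_h`. [cite: Balaban1984PropagatorsII, (2.1) p.224, p.235, bookkeeping] -/
theorem pow_le_side_div (D' : B6MultiLevelBoxOperatorL0.Domains d ℓ Mh k P R) (hMh : 1 ≤ Mh) {i : ↥(cubes D')} {n : ℕ} (hn : n ≤ i.1.1 + 1) :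
    (((ℓ + 1) ^ n : ℕ) : ℝ) ≤ side D' i / Mh := by
  have hM : (0 : ℝ) < Mh := by exact_mod_cast hMh
  rw [side_eq, le_div_iff₀ hM]
  exact mul_le_mul_of_nonneg_right (powL_mono hn) hM.le

/-- **THE SITES OF A BLOCK OF `□̃` ARE WITHIN `7S/4 + S/16` OF THE CENTRE, COORDINATEWISE** (`M_h ≥ 8`, `R ≥ 3L`).
[cite: Balaban1984PropagatorsII, p.239 («ζ_□ ∈ C₀^∞(□̃)»), p.235, (2.2) p.224] -/
theorem abs_sub_ctr_le_of_mem_Qbig (D' : B6MultiLevelBoxOperatorL0.Domains d ℓ Mh k P R) (hMh : 8 ≤ Mh) (hR : 3 * (ℓ + 1) ≤ R) {i : ↥(cubes D')} {y : ↥(bset D')}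
    (hy : y ∈ Qbig D' i) {x : ↥(boxDom (N0 ℓ Mh k P))} (hx : blkOf D' x = y) (μ : Fin (d + 1)) :
    |toR x.1 μ - ctr D' i μ| ≤ 7 / 4 * side D' i + side D' i / 16 := by
  have hMh1 : 1 ≤ Mh := le_trans (by norm_num) hMh
  have hM8 : (8 : ℝ) ≤ Mh := by exact_mod_cast hMh
  have hS := side_pos D' hMh1 i
  have hlev := (window_big D' hMh1 hR hy).2
  have h1 := dist_toR_cen_le D' hx
  have h2 := (mem_Qbig D').1 hy
  have h3 := pow_le_side_div D' hMh1 (i := i) hlev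
  have h4 : side D' i / Mh ≤ side D' i / 8 := div_le_div_of_nonneg_left hS.le (by norm_num) hM8
  have hμ := (dist_le_pi_dist (toR x.1) (ctr D' i) μ).trans (dist_triangle (toR x.1) (cen D' y) (ctr D' i))
  rw [Real.dist_eq] at hμ
  linarith

/-- **THE GAP IN THE BOX BETWEEN `□̃` AND THE FAR BLOCKS**: `d(y, y′) ≥ M_h/8` for `y ∈ □̃` and `y′ ∋ x′` with `|x′_μ − ctr_μ| ≥ 2S − 1` for some `μ`
(`M_h ≥ 16`, `R ≥ 3L`). [cite: Balaban1984PropagatorsII, (2.46) p.231 with (2.2) p.224; p.247 («ζ_□(y) − 1 = 0 for d(y, y′) ≦ M»); derivation ours] -/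
theorem gap_box_far (D' : B6MultiLevelBoxOperatorL0.Domains d ℓ Mh k P R) (hMh : 16 ≤ Mh) (hP : ∀ μ, 1 ≤ P μ) (hR : 3 * (ℓ + 1) ≤ R) {i : ↥(cubes D')} {y y' : ↥(bset D')}
    (hy : y ∈ Qbig D' i) (hy' : ∃ x' : ↥(boxDom (N0 ℓ Mh k P)), blkOf D' x' = y' ∧ ∃ μ, 2 * side D' i - 1 ≤ |toR x'.1 μ - ctr D' i μ|) :
    (Mh : ℝ) / 8 ≤ ((bond D').dist y y' : ℝ) := by
  have hMh1 : 1 ≤ Mh := le_trans (by norm_num) hMh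
  have hM16 : (16 : ℝ) ≤ Mh := by exact_mod_cast hMh
  have hM0 : (0 : ℝ) < Mh := by linarith
  have hS := side_pos D' hMh1 i
  have eS : side D' i = (((ℓ + 1) ^ (i.1.1 + 1) : ℕ) : ℝ) * Mh := side_eq D' i
  have hLp : (0 : ℝ) < (((ℓ + 1) ^ (i.1.1 + 1) : ℕ) : ℝ) := by positivity
  have hL1 : (1 : ℝ) ≤ (((ℓ + 1) ^ (i.1.1 + 1) : ℕ) : ℝ) := by exact_mod_cast Nat.one_le_pow _ _ (by omega)
  have hlev : y.1.1 ≤ i.1.1 + 1 := (window_big D' hMh1 hR hy).2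
  have hQ := (mem_Qbig D').1 hy
  obtain ⟨p, hp⟩ := ((connected (D := D') hMh1 hP).preconnected y y').exists_walk_length_eq_dist
  -- the length in units: `S/M_h = L^{j+1}` per bond
  have key : side D' i / 8 ≤ ((bond D').dist y y' : ℝ) * (((ℓ + 1) ^ (i.1.1 + 1) : ℕ) : ℝ) := by
    rcases walk_disp_or_exit_lev (m := i.1.1 + 1) p hlev with ⟨hb, hdisp⟩ | ⟨t, ht, hdist⟩
    · -- the chain stays at levels ≤ j + 1: the far site forces a displacement ≥ 3S/16 − 1
      rw [hp] at hdisp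
      obtain ⟨x', hx', μ, hfar⟩ := hy'
      have h1 := dist_toR_cen_le D' hx'
      have h3 := pow_le_side_div D' hMh1 (i := i) hb
      have h4 : side D' i / Mh ≤ side D' i / 16 := div_le_div_of_nonneg_left hS.le (by norm_num) hM16
      have hx'c : |toR x'.1 μ - cen D' y' μ| ≤ side D' i / 32 := by
        have := dist_le_pi_dist (toR x'.1) (cen D' y') μ
        rw [Real.dist_eq] at this
        linarith
      have hyc : |cen D' y μ - ctr D' i μ| ≤ 7 / 4 * side D' i := by
        have := dist_le_pi_dist (cen D' y) (ctr D' i) μ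
        rw [Real.dist_eq] at this
        linarith
      have hdispμ : |cen D' y μ - cen D' y' μ| ≤ ((bond D').dist y y' : ℝ) * (((ℓ + 1) ^ (i.1.1 + 1) : ℕ) : ℝ) := by
        have := dist_le_pi_dist (cen D' y) (cen D' y') μ
        rw [Real.dist_eq] at this
        linarith
      -- |x′ − ctr| ≤ |x′ − cen y′| + |cen y′ − cen y| + |cen y − ctr|
      have htri : |toR x'.1 μ - ctr D' i μ| ≤ |toR x'.1 μ - cen D' y' μ| + |cen D' y μ - cen D' y' μ| + |cen D' y μ - ctr D' i μ| := by
        have e : toR x'.1 μ - ctr D' i μ = (toR x'.1 μ - cen D' y' μ) + (cen D' y' μ - cen D' y μ) + (cen D' y μ - ctr D' i μ) := by ring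
        rw [e]
        have a1 := abs_add_le ((toR x'.1 μ - cen D' y' μ) + (cen D' y' μ - cen D' y μ)) (cen D' y μ - ctr D' i μ)
        have a2 := abs_add_le (toR x'.1 μ - cen D' y' μ) (cen D' y' μ - cen D' y μ)
        have a3 : |cen D' y' μ - cen D' y μ| = |cen D' y μ - cen D' y' μ| := abs_sub_comm _ _
        linarith
      have hS16 : (1 : ℝ) ≤ side D' i / 16 := by
        rw [eS, le_div_iff₀ (by norm_num : (0 : ℝ) < 16)]; nlinarith
      nlinarith
    · -- the chain exits to `B^{j+2}`: (2.2) puts the exit site `> (RL − 9/4)S` away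
      rw [hp] at hdist
      have hfar := far_exit D' hMh1 (t := t) (by omega)
      have htri : dist (ctr D' i) (toR t.1) ≤ dist (cen D' y) (ctr D' i) + dist (cen D' y) (toR t.1) := by
        rw [dist_comm (cen D' y) (ctr D' i)]; exact dist_triangle _ _ _
      have hR3 : (3 : ℝ) * ((ℓ : ℝ) + 1) ≤ R := by exact_mod_cast hR
      have hL2 : (1 : ℝ) ≤ (ℓ : ℝ) + 1 := by linarith [(Nat.cast_nonneg ℓ : (0 : ℝ) ≤ ℓ)]
      have hRL : (3 : ℝ) ≤ (R : ℝ) * ((ℓ : ℝ) + 1) := by nlinarith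
      nlinarith
  rw [eS] at key
  -- divide by `L^{j+1}`
  by_contra hlt
  push Not at hlt
  have : ((bond D').dist y y' : ℝ) * (((ℓ + 1) ^ (i.1.1 + 1) : ℕ) : ℝ) < (Mh : ℝ) / 8 * (((ℓ + 1) ^ (i.1.1 + 1) : ℕ) : ℝ) :=
    mul_lt_mul_of_pos_right hlt hLp
  linarith

/-! ## §3  The central cube of a chart: depth of `□̃`, and the gap on the torus -/

variable {D : TDomains d ℓ Mh k P R}

/-- **THE BLOCKS OF `□̃` OF THE CENTRAL CUBE ARE `⌊S/2⌋`-DEEP, OF LEVEL `≤ j + 1`** (`M_h ≥ 8`, `R ≥ 3L`, `P_μ ≥ 5`): their sites are within `2S` of the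
centre, which is `≥ 2S_k + S/2` from every wall. [cite: Balaban1984PropagatorsII, p.238–239 (□̃ inside T_□), (2.46) p.231, dictionary (charts)] -/
theorem blkDeep_of_mem_Qbig (hMh : 8 ≤ Mh) (hR : 3 * (ℓ + 1) ≤ R) (hP5 : ∀ μ, 5 ≤ P μ) {hMh1 : 1 ≤ Mh} {hP4 : ∀ μ, 4 ≤ P μ}
    (c : ↥(B6Cover236MultiLevelBlocksL0.cubes D.toDomains)) {y : ↥(bset (Dch D c))} (hy : y ∈ Qbig (Dch D c) (cc D hMh1 hP4 c)) :
    BlkDeep (Dch D c) (((bigSide ℓ Mh c.1.1 : ℕ) : ℤ) / 2) y ∧ y.1.1 ≤ c.1.1 + 1 := by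
  have hlev : y.1.1 ≤ c.1.1 + 1 := (window_big (Dch D c) hMh1 hR hy).2
  refine ⟨fun x hx μ => ?_, hlev⟩
  have hxc := abs_sub_ctr_le_of_mem_Qbig (Dch D c) hMh hR hy hx μ
  rw [side_cc] at hxc
  obtain ⟨h1, h2⟩ := ctr_cc_bounds hMh1 hP4 c μ
  have hP : (5 : ℝ) ≤ P μ := by exact_mod_cast hP5 μ
  have hSk : (bigSide ℓ Mh c.1.1 : ℝ) ≤ (bigSide ℓ Mh k : ℝ) := by rw [← side_cc hMh1 hP4 c]; exact side_le_bigSide_k _ _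
  have hS0 : (0 : ℝ) ≤ (bigSide ℓ Mh c.1.1 : ℝ) := by positivity
  rw [abs_le] at hxc
  have ex : toR x.1 μ = (x.1 μ : ℝ) := rfl
  rw [ex] at hxc
  -- `⌊S/2⌋ ≤ S/2` as reals
  have hdiv : ((((bigSide ℓ Mh c.1.1 : ℕ) : ℤ) / 2 : ℤ) : ℝ) ≤ (bigSide ℓ Mh c.1.1 : ℝ) / 2 := by
    have h := Int.ediv_mul_le (((bigSide ℓ Mh c.1.1 : ℕ) : ℤ)) (b := 2) (by norm_num)
    have h' : ((((bigSide ℓ Mh c.1.1 : ℕ) : ℤ) / 2 : ℤ) : ℝ) * 2 ≤ (((bigSide ℓ Mh c.1.1 : ℕ) : ℤ) : ℝ) := by exact_mod_cast h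
    push_cast at h'
    linarith
  have hlo : ((((bigSide ℓ Mh c.1.1 : ℕ) : ℤ) / 2 : ℤ) : ℝ) ≤ ((x.1 μ : ℤ) : ℝ) := by nlinarith [hxc.1]
  have hPS : 2 * (bigSide ℓ Mh k : ℝ) ≤ ((P μ : ℝ) - 3) * (bigSide ℓ Mh k : ℝ) := by
    have hSk0 : (0 : ℝ) ≤ (bigSide ℓ Mh k : ℝ) := by positivity
    nlinarith
  have hhi : ((x.1 μ + ((bigSide ℓ Mh c.1.1 : ℕ) : ℤ) / 2 : ℤ) : ℝ) ≤ (((N0 ℓ Mh k P μ : ℕ) : ℤ) : ℝ) := by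
    rw [Int.cast_add, Int.cast_natCast]
    linarith [hxc.2]
  exact ⟨Int.cast_le.1 hlo, Int.cast_le.1 hhi⟩

/-- **THE GAP ON THE TORUS BETWEEN `□̃` AND THE FAR BLOCKS**: in the chart frame of a torus cube, a block `y ∈ □̃` of the central cube and a block
`y′ ∋ x′` with `|x′_μ − ctr_μ| ≥ 2S − 1` for some `μ` satisfy `d_T(y, y′) ≥ M_h/(4L)` in the torus distance (2.46) (`M_h ≥ 16`, `R ≥ 2L²`, `P_μ ≥ 5`).
This is the depth `M₀` of the line-3 cut-offs `ζ_□`, `h_□` (supported over `□̃`) below the zone of the domain change and below the faces of the window.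
[cite: Balaban1984PropagatorsII, (2.46) p.231, (2.2) p.224, p.247 («ζ_□(y) − 1 = 0 for d(y, y′) ≦ M»), p.238; derivation ours] -/
theorem distT_far (hℓ : 1 ≤ ℓ) (hMh : 16 ≤ Mh) (hR2 : 2 * (ℓ + 1) ^ 2 ≤ R) (hP5 : ∀ μ, 5 ≤ P μ) {hMh1 : 1 ≤ Mh} {hP4 : ∀ μ, 4 ≤ P μ}
    (c : ↥(B6Cover236MultiLevelBlocksL0.cubes D.toDomains)) {y y' : ↥(bset (Dch D c))} (hy : y ∈ Qbig (Dch D c) (cc D hMh1 hP4 c))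
    (hy' : ∃ x' : ↥(boxDom (N0 ℓ Mh k P)), blkOf (Dch D c) x' = y' ∧
      ∃ μ, 2 * (bigSide ℓ Mh c.1.1 : ℝ) - 1 ≤ |toR x'.1 μ - ctr (Dch D c) (cc D hMh1 hP4 c) μ|) :
    (Mh : ℝ) / (4 * ((ℓ : ℝ) + 1)) ≤ ((bondT (D.chart (svec ℓ k c.1.1 c.1.2))).dist y y' : ℝ) := by
  have hP : ∀ μ, 1 ≤ P μ := one_le_of_four_le hP4
  have hM8 : 8 ≤ Mh := le_trans (by norm_num) hMh
  have hM16 : (16 : ℝ) ≤ Mh := by exact_mod_cast hMh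
  have hR : 3 * (ℓ + 1) ≤ R := le_trans (by nlinarith) hR2
  have hL : (2 : ℝ) ≤ (ℓ : ℝ) + 1 := by
    have : (1 : ℝ) ≤ ℓ := by exact_mod_cast hℓ
    linarith
  have hL0 : (0 : ℝ) < (ℓ : ℝ) + 1 := by linarith
  set n : ℕ := (bondT (D.chart (svec ℓ k c.1.1 c.1.2))).dist y y' with hn
  have hn0 : (0 : ℝ) ≤ (n : ℝ) := Nat.cast_nonneg _
  obtain ⟨hdeep, hlev⟩ := blkDeep_of_mem_Qbig (D := D) hM8 hR hP5 c hy
  have hy'side : ∃ x' : ↥(boxDom (N0 ℓ Mh k P)), blkOf (Dch D c) x' = y' ∧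
      ∃ μ, 2 * side (Dch D c) (cc D hMh1 hP4 c) - 1 ≤ |toR x'.1 μ - ctr (Dch D c) (cc D hMh1 hP4 c) μ| := by
    rw [side_cc]; exact hy'
  have hbox := gap_box_far (Dch D c) hMh hP hR hy hy'side
  -- the three cases of p38's trichotomy
  rcases distT_trichotomy (D := D.chart (svec ℓ k c.1.1 c.1.2)) hMh1 hP hdeep y' with h | h | h
  · -- the torus geodesic is a box geodesic
    have e : ((bond (Dch D c)).dist y y' : ℝ) = (n : ℝ) := by rw [hn]; exact_mod_cast h
    rw [e] at hbox
    have : (Mh : ℝ) / (4 * ((ℓ : ℝ) + 1)) ≤ (Mh : ℝ) / 8 := by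
      rw [div_le_div_iff₀ (by positivity) (by norm_num)]; nlinarith
    linarith
  · -- long at the scale of `y`: `⌊S/2⌋ < 2 + n·L^{j(y)+1} ≤ 2 + n·L^{j+2}`
    have eS : (((bigSide ℓ Mh c.1.1 : ℕ) : ℤ) : ℝ) = (Mh : ℝ) * ((ℓ : ℝ) + 1) ^ (c.1.1 + 1) := by
      unfold bigSide; push_cast; ring
    have h' : ((((bigSide ℓ Mh c.1.1 : ℕ) : ℤ) / 2 : ℤ) : ℝ) < 2 + (n : ℝ) * (((ℓ + 1) ^ (y.1.1 + 1) : ℕ) : ℝ) := by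
      rw [hn]; exact_mod_cast h
    -- `⌊S/2⌋ ≥ (S − 1)/2`
    have hdiv : ((bigSide ℓ Mh c.1.1 : ℝ) - 1) / 2 ≤ ((((bigSide ℓ Mh c.1.1 : ℕ) : ℤ) / 2 : ℤ) : ℝ) := by
      have h1 := Int.lt_ediv_add_one_mul_self (((bigSide ℓ Mh c.1.1 : ℕ) : ℤ)) (b := 2) (by norm_num)
      have h2 : (((bigSide ℓ Mh c.1.1 : ℕ) : ℤ) : ℝ) < (((((bigSide ℓ Mh c.1.1 : ℕ) : ℤ) / 2 : ℤ) : ℝ) + 1) * 2 := by exact_mod_cast h1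
      have h3 : (((bigSide ℓ Mh c.1.1 : ℕ) : ℤ) : ℝ) = (bigSide ℓ Mh c.1.1 : ℝ) := by push_cast; ring
      rw [h3] at h2
      -- integrality: `S < (q+1)·2` with integers gives `S ≤ 2q + 1`
      have h4 : ((bigSide ℓ Mh c.1.1 : ℕ) : ℤ) ≤ 2 * ((((bigSide ℓ Mh c.1.1 : ℕ) : ℤ) / 2)) + 1 := by
        have := Int.lt_ediv_add_one_mul_self (((bigSide ℓ Mh c.1.1 : ℕ) : ℤ)) (b := 2) (by norm_num)
        omega
      have h5 : (bigSide ℓ Mh c.1.1 : ℝ) ≤ 2 * ((((bigSide ℓ Mh c.1.1 : ℕ) : ℤ) / 2 : ℤ) : ℝ) + 1 := by exact_mod_cast h4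
      linarith
    have hpow : (((ℓ + 1) ^ (y.1.1 + 1) : ℕ) : ℝ) ≤ ((ℓ : ℝ) + 1) ^ (c.1.1 + 2) := by
      have := powL_mono (ℓ := ℓ) (show y.1.1 + 1 ≤ c.1.1 + 2 by omega)
      push_cast at this ⊢
      linarith
    have hSr : (bigSide ℓ Mh c.1.1 : ℝ) = (Mh : ℝ) * ((ℓ : ℝ) + 1) ^ (c.1.1 + 1) := by unfold bigSide; push_cast; ring
    -- `n·L^{j+2} ≥ (S − 5)/2`
    have h6 : ((Mh : ℝ) * ((ℓ : ℝ) + 1) ^ (c.1.1 + 1) - 5) / 2 ≤ (n : ℝ) * ((ℓ : ℝ) + 1) ^ (c.1.1 + 2) := by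
      have := mul_le_mul_of_nonneg_left hpow hn0
      rw [hSr] at hdiv
      linarith
    -- hence `n ≥ (M_h − 5/L^{j+1})/(2L) ≥ M_h/(4L)` for `M_h ≥ 10`
    have hLj : (1 : ℝ) ≤ ((ℓ : ℝ) + 1) ^ (c.1.1 + 1) := one_le_pow₀ (by linarith)
    have hLj0 : (0 : ℝ) < ((ℓ : ℝ) + 1) ^ (c.1.1 + 1) := by positivity
    rw [div_le_iff₀ (by positivity)]
    have e : (n : ℝ) * ((ℓ : ℝ) + 1) ^ (c.1.1 + 2) = ((n : ℝ) * (4 * ((ℓ : ℝ) + 1))) * (((ℓ : ℝ) + 1) ^ (c.1.1 + 1) / 4) := by ring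
    rw [e] at h6
    by_contra hlt
    push Not at hlt
    have h7 : ((n : ℝ) * (4 * ((ℓ : ℝ) + 1))) * (((ℓ : ℝ) + 1) ^ (c.1.1 + 1) / 4) < (Mh : ℝ) * (((ℓ : ℝ) + 1) ^ (c.1.1 + 1) / 4) :=
      mul_lt_mul_of_pos_right hlt (by positivity)
    have h8 : (16 : ℝ) ≤ (Mh : ℝ) * ((ℓ : ℝ) + 1) ^ (c.1.1 + 1) := by nlinarith
    linarith
  · -- the geodesic climbs two levels: `n ≥ R·(L·M_h)`
    have h' : (R : ℝ) * (((ℓ : ℝ) + 1) * Mh) ≤ (n : ℝ) := by rw [hn]; exact_mod_cast h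
    have hR1 : (1 : ℝ) ≤ R := by
      have : (3 : ℝ) * ((ℓ : ℝ) + 1) ≤ R := by exact_mod_cast hR
      nlinarith
    rw [div_le_iff₀ (by positivity)]
    have hM0 : (0 : ℝ) ≤ (Mh : ℝ) := by positivity
    have hLM : (Mh : ℝ) ≤ (R : ℝ) * (((ℓ : ℝ) + 1) * Mh) := by
      calc (Mh : ℝ) = 1 * (1 * Mh) := by ring
        _ ≤ (R : ℝ) * (((ℓ : ℝ) + 1) * Mh) := by gcongr; linarith
    have hn4 : (n : ℝ) ≤ (n : ℝ) * (4 * ((ℓ : ℝ) + 1)) := by nlinarith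
    linarith

end

end Literature.MathematicalPhysics.QuantumFieldTheory.Balaban1983to89.B6Line3GapV1L0
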